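import Literature.Barriers.RiemannHypothesis.TuranPartialSumsDitheredContour
import Mathlib.Analysis.Calculus.MeanValue
import Mathlib.Analysis.Complex.Convex
import HarnessLib

/-!
# Montgomery 1983, §4 for a twist with finitely many singularities: the estimates of the pieces

Barrier catalogue `Literature/Barriers/RiemannHypothesis/`, proofs and auxiliary definitions only (no
named facts); sequel of `TuranPartialSumsDitheredContour.lean`, which decomposed the twisted section
`F_N(s) − F(s)` of an `EulerTwistData` into the cut integrals `cut_n` (Laplace integrals with the
algebraic endpoint singularity `u^{−μ_n}`), the three far edges of the rectangle and the Perron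
remainder. Here every piece is estimated, for `s` in the box `1 < σ`, `−1/4 ≤ t ≤ 3/4` and `N` with
`L' ≥ 1`, `T ≥ K + 2` (Montgomery's (22)–(24)):

* the cut amplitudes `q_n(u) = W_n(u)/(1 − u + in − s)`, `W_n(u) = ‖ζ₁(1−u)‖^{μ_n} H_n(1−u+in)`, are
  bounded by ONE constant `W_max` on the uniform segment `u ∈ [0, ℓ₀]`, `ℓ₀ = 4c̄/log(2K+6) ≥ ℓ`
  (`exists_Wmax`, compactness), and `W_1` is Lipschitz there (`exists_lipschitz_W_one`: `W_1(u)` is the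
  restriction to the real axis of the holomorphic `Ψ(w) = exp(μ₁ logZeta₁ w) H₁(w + i)`, whose
  derivative is bounded on a compact convex box — the mean value inequality);
* hence (`norm_cut_le`, `norm_cut_zero_le`) `‖cut_n‖ ≤ 8 W_max Γ(1−μ_n) x^{1−σ} L'^{μ_n−1}` for
  `n ≠ 0`, `‖cut_0‖ ≤ 2 W_max Γ(1−μ₀) x^{1−σ} L'^{μ₀−1}/(σ−1)`, and (`norm_cut_one_sub_le`) the main cut
  `cut_1 = 2i sin(πμ₁) x^{1+i−s} (H₁(1+i)/(1+i−s)) Γ(1−μ₁) L'^{μ₁−1} + O(x^{1−σ}(L'^{μ₁−2} + e^{−ℓL'/2}L'^{μ₁−1}))`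
  (`Literature/Analysis/Asymptotics/LaplaceEndpointAlgebraic.lean`);
* the far edges (`norm_top_le`, `norm_bottom_le`, `norm_left_le`):
  `‖top‖, ‖bottom‖ ≤ 2 Gbound(1) x^{σ_R−σ}/T`, `‖left‖ ≤ 2T Gbound(ℓ) x^{σ_L−σ}/(σ − σ_L)`;
* **the pre-asymptotic estimate** `norm_sub_mainTerm_le`: with
  `𝔠 = (sin(πμ₁)Γ(1−μ₁)/π) H₁(1+i)` and `Main(s) = 𝔠 x^{1+i−s} L'^{μ₁−1}/(1+i−s)`,
  `‖F_N(s) − F(s) − Main(s)‖ ≤` an explicit sum of the above bounds.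

The passage to `N → ∞` (each bound is `o(x^{1−σ}L'^{μ₁−1})` under Montgomery's gap conditions
`μ_n < μ₁` (`n ∉ {0,1}`), `μ₀ < μ₁ − 1`) is in `TuranPartialSumsDitheredAsymptotic.lean`.

## References

* [Montgomery1983] H. L. Montgomery, *Zeros of approximations to the zeta function*, in: Studies in
  Pure Mathematics to the memory of Paul Turán, Birkhäuser 1983, 497–506: §4 (22)–(24).
* [Tenenbaum2015] G. Tenenbaum, *Introduction to analytic and probabilistic number theory*, 3rd ed.,
  AMS GSM 163, II.5 §5.2 (the same estimates in the Selberg–Delange method).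
-/

noncomputable section

open Complex Set MeasureTheory Filter Topology intervalIntegral
open Literature.NumberTheory.LFunctions Literature.Analysis.Complex Literature.Analysis.Asymptotics

namespace Literature.Barriers.RiemannHypothesis

open DitheredContour

namespace EulerTwistData

variable (D : EulerTwistData)

/-! ## The uniform segment `[0, ℓ₀]` of the cuts -/

/-- `ℓ₀ = 4c̄/log(2K + 6)`, an upper bound for the depth `ℓ` whenever `T ≥ K + 2`. [folklore] -/
def ℓ₀ : ℝ := 4 * zfrConst / Real.log (2 * D.K + 6)

/-- Auxiliary step `one_lt_log_two_K_add_six` (see the module docstring). [folklore] -/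
theorem one_lt_log_two_K_add_six : 1 < Real.log (2 * (D.K : ℝ) + 6) := by
  have hK : (0 : ℝ) ≤ D.K := Nat.cast_nonneg _
  have : Real.exp 1 < 2 * (D.K : ℝ) + 6 := by
    have := Real.exp_one_lt_d9; linarith
  rwa [Real.lt_log_iff_exp_lt (by linarith)]

/-- Auxiliary step `ℓ₀_pos` (see the module docstring). [folklore] -/
theorem ℓ₀_pos : 0 < D.ℓ₀ :=
  div_pos (mul_pos four_pos zfrConst_pos) (lt_trans zero_lt_one D.one_lt_log_two_K_add_six)

/-- Auxiliary step `ℓ₀_le` (see the module docstring). [folklore] -/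
theorem ℓ₀_le : D.ℓ₀ ≤ 1 / 25 := by
  unfold ℓ₀
  have h1 := D.one_lt_log_two_K_add_six
  have h2 : 4 * zfrConst / Real.log (2 * D.K + 6) ≤ 4 * zfrConst := by
    rw [div_le_iff₀ (by linarith)]; nlinarith [zfrConst_pos]
  linarith [zfrConst_le]

variable {D}
variable {N : ℕ}

/-- `ℓ ≤ ℓ₀` as soon as `T ≥ K + 2`. [folklore] -/
theorem ℓ_le_ℓ₀ (hT : (D.K : ℝ) + 2 ≤ T N) : ℓ D.K N ≤ D.ℓ₀ := by
  unfold ℓ ℓ₀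
  have h1 := D.one_lt_log_two_K_add_six
  refine div_le_div_of_nonneg_left (mul_pos four_pos zfrConst_pos).le (by linarith) ?_
  refine Real.log_le_log (by have : (0:ℝ) ≤ D.K := Nat.cast_nonneg _; linarith) ?_
  unfold Y; linarith

/-- Points with `Re w ≥ 1 − ℓ₀` and `|Im w| < 2K + 3` lie in the classical region. [folklore] -/
theorem mem_zfrRegion_of_ℓ₀ {w : ℂ} (hre : 1 - D.ℓ₀ ≤ w.re) (him : |w.im| < 2 * D.K + 3) :
    w ∈ zfrRegion := by
  rw [mem_zfrRegion]
  have h3 : 1 < |w.im| + 3 := by linarith [abs_nonneg w.im]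
  have hlog : Real.log (|w.im| + 3) < Real.log (2 * D.K + 6) := Real.log_lt_log (by linarith) (by linarith)
  have hlog0 : 0 < Real.log (|w.im| + 3) := Real.log_pos h3
  have hlt : D.ℓ₀ < zfrWidth w.im := by
    unfold ℓ₀ zfrWidth
    exact div_lt_div_of_pos_left (mul_pos four_pos zfrConst_pos) hlog0 hlog
  linarith

/-- The point `1 − u + in` of the `n`-th cut. [folklore] -/
def cutPt (n : ℤ) (u : ℝ) : ℂ := ((1 - u : ℝ) : ℂ) + n * I

/-- Auxiliary step `cutPt_re` (see the module docstring). [folklore] -/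
theorem cutPt_re (n : ℤ) (u : ℝ) : (cutPt n u).re = 1 - u := by simp [cutPt]

/-- Auxiliary step `cutPt_im` (see the module docstring). [folklore] -/
theorem cutPt_im (n : ℤ) (u : ℝ) : (cutPt n u).im = n := by simp [cutPt]

/-- On the uniform segment the real point `1 − u` is in the region. [folklore] -/
theorem ofReal_one_sub_mem {u : ℝ} (hu : u ∈ Icc 0 D.ℓ₀) :
    ((1 - u : ℝ) : ℂ) ∈ zfrRegion :=
  mem_zfrRegion_of_ℓ₀ (D := D) (by rw [show (((1 - u : ℝ) : ℂ)).re = 1 - u by simp]; linarith [hu.2])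
    (by rw [show (((1 - u : ℝ) : ℂ)).im = 0 by simp]; have : (0:ℝ) ≤ D.K := Nat.cast_nonneg _; simp; linarith)

/-- … and the other shifts of `1 − u + in` are off their cuts. [folklore] -/
theorem cutPt_other_shifts {n : ℤ} (hn : n ∈ D.S) {u : ℝ} (hu : u ∈ Icc 0 D.ℓ₀) :
    ∀ n' ∈ D.S, n' ≠ n → cutPt n u - n' * I ∈ zfrSlitRegion := by
  intro n' hn' hne
  have h1 := D.abs_intCast_le_K hn
  have h2 := D.abs_intCast_le_K hn'
  refine mem_zfrSlitRegion_of_im_ne_zero (mem_zfrRegion_of_ℓ₀ (D := D) ?_ ?_) ?_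
  · rw [show (cutPt n u - n' * I).re = 1 - u by simp [cutPt]]; linarith [hu.2]
  · have : (cutPt n u - n' * I).im = n - n' := by simp [cutPt]
    rw [this]
    have : |(n : ℝ) - n'| ≤ |(n : ℝ)| + |(n' : ℝ)| := abs_sub _ _
    linarith
  · have : (cutPt n u - n' * I).im = n - n' := by simp [cutPt]
    rw [this]
    exact sub_ne_zero.2 (by exact_mod_cast hne.symm)

/-- Auxiliary step `cutPt_re_gt` (see the module docstring). [folklore] -/
theorem cutPt_re_gt {u : ℝ} (hu : u ∈ Icc 0 D.ℓ₀) (n : ℤ) : 3 / 4 < (cutPt n u).re := by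
  rw [cutPt_re]; linarith [hu.2, D.ℓ₀_le]

/-! ## The amplitudes `W_n` and their uniform bound -/

/-- `W_n(u) = ‖ζ₁(1 − u)‖^{μ_n} H_n(1 − u + in)`, so that `q_n(u) = W_n(u)/(1 − u + in − s)`.
[cite: Montgomery1983, §4 (22)] -/
def W (D : EulerTwistData) (n : ℤ) (u : ℝ) : ℂ :=
  ((‖riemannZeta₁ ((1 - u : ℝ) : ℂ)‖ ^ (D.μ n) : ℝ) : ℂ) * D.H n (cutPt n u)

/-- Auxiliary step `q_eq_W_div` (see the module docstring). [folklore] -/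
theorem q_eq_W_div (s : ℂ) (n : ℤ) (u : ℝ) : q D s n u = W D n u / (cutPt n u - s) := rfl

/-- `W_n` is continuous on `[0, ℓ₀]`. [folklore] -/
theorem continuousOn_W {n : ℤ} (hn : n ∈ D.S) : ContinuousOn (W D n) (Icc 0 D.ℓ₀) := by
  intro u hu
  have hreg := ofReal_one_sub_mem (D := D) hu
  -- the real factor
  have h1 : ContinuousAt (fun u : ℝ ↦ ((‖riemannZeta₁ ((1 - u : ℝ) : ℂ)‖ ^ (D.μ n) : ℝ) : ℂ)) u := by
    have hc : ContinuousAt (fun u : ℝ ↦ ‖riemannZeta₁ ((1 - u : ℝ) : ℂ)‖) u := by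
      have hp : ContinuousAt (fun u : ℝ ↦ ((1 - u : ℝ) : ℂ)) u := by fun_prop
      exact (ContinuousAt.comp_of_eq differentiable_riemannZeta₁.continuous.continuousAt hp rfl).norm
    exact continuous_ofReal.continuousAt.comp
      (hc.rpow_const (Or.inl (norm_ne_zero_iff.2 (riemannZeta₁_ne_zero_of_mem_zfrRegion hreg))))
  -- the cofactor
  have h2 : ContinuousAt (fun u : ℝ ↦ D.H n (cutPt n u)) u := by
    have hp : ContinuousAt (fun u : ℝ ↦ cutPt n u) u := by unfold cutPt; fun_prop
    exact ContinuousAt.comp_of_eq (D.continuousAt_H (cutPt_other_shifts hn hu) (cutPt_re_gt hu n)) hp rfl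
  exact (h1.mul h2).continuousWithinAt

/-- **One bound for all amplitudes**: `‖W_n(u)‖ ≤ W_max` for `n ∈ S`, `u ∈ [0, ℓ₀]`. [folklore] -/
theorem exists_Wmax : ∃ Wm : ℝ, 0 ≤ Wm ∧ ∀ n ∈ D.S, ∀ u ∈ Icc 0 D.ℓ₀, ‖W D n u‖ ≤ Wm := by
  have hev : ∀ n ∈ D.S, ∀ᶠ C in atTop, ∀ u ∈ Icc 0 D.ℓ₀, ‖W D n u‖ ≤ C := by
    intro n hn
    obtain ⟨B, hB⟩ := (isCompact_Icc (a := (0:ℝ)) (b := D.ℓ₀)).exists_bound_of_continuousOn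
      (continuousOn_W hn)
    filter_upwards [eventually_ge_atTop B] with C hC u hu
    exact (hB u hu).trans hC
  obtain ⟨C, hC0, hC⟩ := ((eventually_ge_atTop (0 : ℝ)).and
    ((Filter.eventually_all_finset D.S).2 hev)).exists
  exact ⟨C, hC0, hC⟩

/-! ## The main amplitude `W_1` is Lipschitz at `u = 0` -/

/-- `Ψ(w) = exp(μ₁ logZeta₁ w) H₁(w + i)`, holomorphic near the real segment `[1 − ℓ₀, 1]`, with
`Ψ(1 − u) = W_1(u)`. [cite: Tenenbaum2015, II.5 §5.2] -/
def Ψ (D : EulerTwistData) (w : ℂ) : ℂ := exp (D.μ 1 * logZeta₁ w) * D.H 1 (w + I)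

/-- The open domain of `Ψ`. [folklore] -/
def ΨDom (D : EulerTwistData) : Set ℂ :=
  zfrRegion ∩ ({w : ℂ | ∀ n ∈ D.S, n ≠ 1 → w + I - n * I ∈ zfrSlitRegion} ∩ {w : ℂ | 3 / 4 < w.re})

/-- Auxiliary step `isOpen_ΨDom` (see the module docstring). [folklore] -/
theorem isOpen_ΨDom : IsOpen (ΨDom D) := by
  have h1 : {w : ℂ | ∀ n ∈ D.S, n ≠ 1 → w + I - n * I ∈ zfrSlitRegion} =
      ⋂ n ∈ D.S.erase 1, (fun w : ℂ ↦ w + I - n * I) ⁻¹' zfrSlitRegion := by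
    ext w
    simp only [mem_setOf_eq, mem_iInter, mem_preimage, Finset.mem_erase]
    exact ⟨fun h n hn ↦ h n hn.2 hn.1, fun h n hn hnk ↦ h n ⟨hnk, hn⟩⟩
  refine isOpen_zfrRegion.inter (IsOpen.inter ?_ (isOpen_lt continuous_const continuous_re))
  rw [h1]
  exact isOpen_biInter_finset fun n _ ↦ isOpen_zfrSlitRegion.preimage (by fun_prop)

/-- Auxiliary step `differentiableOn_Ψ` (see the module docstring). [folklore] -/
theorem differentiableOn_Ψ : DifferentiableOn ℂ (Ψ D) (ΨDom D) := by
  intro w hw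
  obtain ⟨hw1, hw2, hw3⟩ := hw
  have h1 : DifferentiableAt ℂ (fun w ↦ exp (D.μ 1 * logZeta₁ w)) w :=
    ((differentiableOn_logZeta₁.differentiableAt (isOpen_zfrRegion.mem_nhds hw1)).const_mul _).cexp
  have h2 : DifferentiableAt ℂ (fun w ↦ D.H 1 (w + I)) w := by
    have hH : DifferentiableAt ℂ (D.H 1) (w + I) := by
      refine D.differentiableAt_H (fun n hn hne ↦ ?_) (by simp; exact hw3)
      exact hw2 n hn hne
    exact hH.comp w (differentiableAt_id.add_const I)
  exact (h1.mul h2).differentiableWithinAt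

/-- The compact convex box `K₁ = [1 − ℓ₀, 1] × [−1/2, 1/2]` around the real segment. [folklore] -/
def ΨBox (D : EulerTwistData) : Set ℂ :=
  ({w : ℂ | 1 - D.ℓ₀ ≤ w.re} ∩ {w : ℂ | w.re ≤ 1}) ∩ ({w : ℂ | -(1 / 2 : ℝ) ≤ w.im} ∩ {w : ℂ | w.im ≤ 1 / 2})

/-- Auxiliary step `convex_ΨBox` (see the module docstring). [folklore] -/
theorem convex_ΨBox : Convex ℝ (ΨBox D) :=
  ((convex_halfSpace_re_ge _).inter (convex_halfSpace_re_le _)).inter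
    ((convex_halfSpace_im_ge _).inter (convex_halfSpace_im_le _))

/-- Auxiliary step `ΨBox_eq` (see the module docstring). [folklore] -/
theorem ΨBox_eq : ΨBox D = Icc (1 - D.ℓ₀) 1 ×ℂ Icc (-(1 / 2 : ℝ)) (1 / 2) := by
  ext w
  simp only [ΨBox, mem_inter_iff, mem_setOf_eq, mem_reProdIm, mem_Icc]

/-- Auxiliary step `isCompact_ΨBox` (see the module docstring). [folklore] -/
theorem isCompact_ΨBox : IsCompact (ΨBox D) := by
  rw [ΨBox_eq]
  exact Metric.isCompact_of_isClosed_isBounded (isClosed_Icc.reProdIm isClosed_Icc)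
    ((Metric.isBounded_Icc _ _).reProdIm (Metric.isBounded_Icc _ _))

/-- Auxiliary step `ΨBox_subset_ΨDom` (see the module docstring). [folklore] -/
theorem ΨBox_subset_ΨDom : ΨBox D ⊆ ΨDom D := by
  intro w hw
  obtain ⟨⟨h1, h2⟩, h3, h4⟩ := hw
  have h1' : 1 - D.ℓ₀ ≤ w.re := h1
  have h3' : -(1 / 2 : ℝ) ≤ w.im := h3
  have h4' : w.im ≤ 1 / 2 := h4
  have hK : (0:ℝ) ≤ D.K := Nat.cast_nonneg _
  refine ⟨mem_zfrRegion_of_ℓ₀ h1' (by rw [abs_lt]; constructor <;> linarith), ?_, ?_⟩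
  · intro n hn hne
    have hnK := D.abs_intCast_le_K hn
    have him : (w + I - n * I).im = w.im + 1 - n := by simp
    refine mem_zfrSlitRegion_of_im_ne_zero (mem_zfrRegion_of_ℓ₀ (D := D)
      (by rw [show (w + I - n * I).re = w.re by simp]; exact h1') ?_) ?_
    · rw [him]
      have := abs_le.1 hnK
      rw [abs_lt]; constructor <;> linarith
    · rw [him]
      intro h0
      have : (1 : ℝ) ≤ |(1 : ℝ) - n| := by
        have h' : (1 : ℤ) ≤ |1 - n| := Int.one_le_abs (sub_ne_zero.2 hne.symm)
        have h'' : ((1 : ℤ) : ℝ) ≤ ((|1 - n| : ℤ) : ℝ) := by exact_mod_cast h'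
        simpa [Int.cast_abs] using h''
      have h5 : |(1 : ℝ) - n| = |w.im| := by
        rw [show (1 : ℝ) - n = -w.im by linarith, abs_neg]
      rw [h5] at this
      have := abs_le.2 ⟨h3', h4'⟩
      linarith
  · show 3 / 4 < w.re
    linarith [D.ℓ₀_le]

/-- **The mean value inequality for `Ψ` on the box**: one Lipschitz constant. [folklore] -/
theorem exists_lipschitz_Ψ : ∃ M : ℝ, 0 ≤ M ∧ ∀ w₁ ∈ ΨBox D, ∀ w₂ ∈ ΨBox D,
    ‖Ψ D w₂ - Ψ D w₁‖ ≤ M * ‖w₂ - w₁‖ := by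
  have hV := isOpen_ΨDom (D := D)
  have hΨ := differentiableOn_Ψ (D := D)
  have han : AnalyticOnNhd ℂ (Ψ D) (ΨDom D) := hΨ.analyticOnNhd hV
  have hder : ContinuousOn (deriv (Ψ D)) (ΨDom D) := han.deriv.continuousOn
  obtain ⟨M, hM⟩ := (isCompact_ΨBox (D := D)).exists_bound_of_continuousOn
    (hder.mono ΨBox_subset_ΨDom)
  have hM0 : 0 ≤ M := by
    have hmem : (1 : ℂ) ∈ ΨBox D := by
      refine ⟨⟨?_, ?_⟩, ?_, ?_⟩
      · show 1 - D.ℓ₀ ≤ (1 : ℂ).re; simp [D.ℓ₀_pos.le]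
      · show (1 : ℂ).re ≤ 1; simp
      · show -(1 / 2 : ℝ) ≤ (1 : ℂ).im; simp
      · show (1 : ℂ).im ≤ 1 / 2; simp
    exact (norm_nonneg _).trans (hM 1 hmem)
  refine ⟨M, hM0, fun w₁ hw₁ w₂ hw₂ ↦ ?_⟩
  exact Convex.norm_image_sub_le_of_norm_deriv_le
    (fun w hw ↦ hΨ.differentiableAt (hV.mem_nhds (ΨBox_subset_ΨDom hw))) hM convex_ΨBox hw₁ hw₂

/-- `W_1(u) = Ψ(1 − u)` on `[0, ℓ₀]`. [folklore] -/
theorem W_one_eq {u : ℝ} (hu : u ∈ Icc 0 D.ℓ₀) : W D 1 u = Ψ D ((1 - u : ℝ) : ℂ) := by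
  rw [W, Ψ, exp_mul_logZeta₁_ofReal (ofReal_one_sub_mem (D := D) hu), cutPt]
  push_cast
  ring_nf

/-- `W_1(0) = H₁(1 + i)` (`ζ₁(1) = 1`). [folklore] -/
theorem W_one_zero : W D 1 0 = D.H 1 (1 + I) := by
  rw [W, cutPt]
  have : ((1 - 0 : ℝ) : ℂ) = 1 := by push_cast; ring
  rw [this, riemannZeta₁_one, norm_one, Real.one_rpow]
  push_cast
  ring_nf

/-- **`W_1` is Lipschitz at `0`**: `‖W_1(u) − W_1(0)‖ ≤ M u` on `[0, ℓ₀]`. [folklore] -/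
theorem exists_lipschitz_W_one : ∃ M : ℝ, 0 ≤ M ∧ ∀ u ∈ Icc 0 D.ℓ₀, ‖W D 1 u - W D 1 0‖ ≤ M * u := by
  obtain ⟨M, hM0, hM⟩ := exists_lipschitz_Ψ (D := D)
  refine ⟨M, hM0, fun u hu ↦ ?_⟩
  have hℓ := D.ℓ₀_pos
  have h0 : (0 : ℝ) ∈ Icc 0 D.ℓ₀ := ⟨le_rfl, hℓ.le⟩
  have hmem : ∀ v ∈ Icc 0 D.ℓ₀, ((1 - v : ℝ) : ℂ) ∈ ΨBox D := by
    intro v hv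
    refine ⟨⟨?_, ?_⟩, ?_, ?_⟩
    · show 1 - D.ℓ₀ ≤ (((1 - v : ℝ) : ℂ)).re; simp; linarith [hv.2]
    · show (((1 - v : ℝ) : ℂ)).re ≤ 1; simp; linarith [hv.1]
    · show -(1 / 2 : ℝ) ≤ (((1 - v : ℝ) : ℂ)).im; simp
    · show (((1 - v : ℝ) : ℂ)).im ≤ 1 / 2; simp
  rw [W_one_eq hu, W_one_eq h0]
  refine (hM _ (hmem 0 h0) _ (hmem u hu)).trans (le_of_eq ?_)
  congr 1
  have : ((1 - u : ℝ) : ℂ) - ((1 - 0 : ℝ) : ℂ) = ((-u : ℝ) : ℂ) := by push_cast; ring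
  rw [this, norm_real, Real.norm_eq_abs, abs_neg, abs_of_nonneg hu.1]

/-! ## Bounds for the amplitudes `q_n` -/

section QBounds

variable {s : ℂ}

/-- The denominators: `‖1 − u + in − s‖ ≥ 1/4` for `n ≠ 0`, `−1/4 ≤ t ≤ 3/4`. [folklore] -/
theorem norm_cutPt_sub_ge {n : ℤ} (hn0 : n ≠ 0) (ht : -(1 / 4 : ℝ) ≤ s.im ∧ s.im ≤ 3 / 4) (u : ℝ) :
    1 / 4 ≤ ‖cutPt n u - s‖ := by
  have h1 : |(cutPt n u - s).im| ≤ ‖cutPt n u - s‖ := abs_im_le_norm _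
  have h2 : (cutPt n u - s).im = n - s.im := by simp [cutPt]
  rw [h2] at h1
  rcases lt_or_gt_of_ne hn0 with h | h
  · have : (n : ℝ) ≤ -1 := by exact_mod_cast (show n ≤ -1 by omega)
    have : |(n : ℝ) - s.im| ≥ 3 / 4 := by rw [abs_of_neg (by linarith)]; linarith
    linarith
  · have : (1 : ℝ) ≤ n := by exact_mod_cast (show 1 ≤ n by omega)
    have : |(n : ℝ) - s.im| ≥ 1 / 4 := by rw [abs_of_pos (by linarith)]; linarith
    linarith

/-- `‖1 − u − s‖ ≥ σ − 1` for the cut at height `0` (`u ≥ 0`). [folklore] -/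
theorem norm_cutPt_zero_sub_ge (hσ : 1 < s.re) {u : ℝ} (hu : 0 ≤ u) :
    s.re - 1 ≤ ‖cutPt 0 u - s‖ := by
  have h1 : |(cutPt 0 u - s).re| ≤ ‖cutPt 0 u - s‖ := abs_re_le_norm _
  have h2 : (cutPt 0 u - s).re = 1 - u - s.re := by simp [cutPt]
  rw [h2, abs_of_neg (by linarith)] at h1
  linarith

/-- **Crude bound**: `‖q_n(u)‖ ≤ 4 W_max` for `n ≠ 0`. [cite: Montgomery1983, §4 (22)] -/
theorem norm_q_le {Wm : ℝ} (hWm : ∀ n ∈ D.S, ∀ u ∈ Icc 0 D.ℓ₀, ‖W D n u‖ ≤ Wm) {n : ℤ}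
    (hn : n ∈ D.S) (hn0 : n ≠ 0) (ht : -(1 / 4 : ℝ) ≤ s.im ∧ s.im ≤ 3 / 4) {u : ℝ}
    (hu : u ∈ Icc 0 D.ℓ₀) : ‖q D s n u‖ ≤ 4 * Wm := by
  have hW := hWm n hn u hu
  have hW0 : 0 ≤ Wm := (norm_nonneg _).trans hW
  have hd := norm_cutPt_sub_ge hn0 ht u
  rw [q_eq_W_div, norm_div]
  rw [div_le_iff₀ (by linarith)]
  nlinarith

/-- **Crude bound at height `0`**: `‖q_0(u)‖ ≤ W_max/(σ − 1)`. [cite: Montgomery1983, §4 (23)] -/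
theorem norm_q_zero_le {Wm : ℝ} (hWm : ∀ n ∈ D.S, ∀ u ∈ Icc 0 D.ℓ₀, ‖W D n u‖ ≤ Wm)
    (h0 : (0 : ℤ) ∈ D.S) (hσ : 1 < s.re) {u : ℝ} (hu : u ∈ Icc 0 D.ℓ₀) :
    ‖q D s 0 u‖ ≤ Wm / (s.re - 1) := by
  have hW := hWm 0 h0 u hu
  have hd := norm_cutPt_zero_sub_ge hσ hu.1
  have hpos : 0 < s.re - 1 := by linarith
  rw [q_eq_W_div, norm_div]
  calc ‖W D 0 u‖ / ‖cutPt 0 u - s‖ ≤ ‖W D 0 u‖ / (s.re - 1) :=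
        div_le_div_of_nonneg_left (norm_nonneg _) hpos hd
    _ ≤ Wm / (s.re - 1) := div_le_div_of_nonneg_right hW hpos.le

/-- `q_1(0) = H₁(1 + i)/(1 + i − s)`. [folklore] -/
theorem q_one_zero (s : ℂ) : q D s 1 0 = D.H 1 (1 + I) / ((1 + I) - s) := by
  rw [q_eq_W_div, W_one_zero]
  congr 1
  simp [cutPt]

/-- **The main amplitude is Lipschitz at `0`**: `‖q_1(u) − q_1(0)‖ ≤ (4M + 16 W_max) u`.
[cite: Montgomery1983, §4 (24)] -/
theorem norm_q_one_sub_le {Wm M : ℝ} (hWm : ∀ n ∈ D.S, ∀ u ∈ Icc 0 D.ℓ₀, ‖W D n u‖ ≤ Wm)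
    (hM : ∀ u ∈ Icc 0 D.ℓ₀, ‖W D 1 u - W D 1 0‖ ≤ M * u)
    (ht : -(1 / 4 : ℝ) ≤ s.im ∧ s.im ≤ 3 / 4) {u : ℝ} (hu : u ∈ Icc 0 D.ℓ₀) :
    ‖q D s 1 u - q D s 1 0‖ ≤ (4 * M + 16 * Wm) * u := by
  have h0 : (0 : ℝ) ∈ Icc 0 D.ℓ₀ := ⟨le_rfl, D.ℓ₀_pos.le⟩
  have hW0 := hWm 1 D.one_mem 0 h0
  have hWm0 : 0 ≤ Wm := (norm_nonneg _).trans hW0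
  have hMu := hM u hu
  have hM0 : 0 ≤ M * u := (norm_nonneg _).trans hMu
  have hdu := norm_cutPt_sub_ge (n := 1) one_ne_zero ht u
  have hd0 := norm_cutPt_sub_ge (n := 1) one_ne_zero ht 0
  have hne_u : cutPt 1 u - s ≠ 0 := norm_pos_iff.1 (by linarith)
  have hne_0 : cutPt 1 0 - s ≠ 0 := norm_pos_iff.1 (by linarith)
  -- algebra
  have hdiff : cutPt 1 0 - cutPt 1 u = (u : ℂ) := by simp [cutPt]
  have e : q D s 1 u - q D s 1 0 =
      (W D 1 u - W D 1 0) / (cutPt 1 u - s) +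
        W D 1 0 * ((u : ℂ) / ((cutPt 1 u - s) * (cutPt 1 0 - s))) := by
    rw [q_eq_W_div, q_eq_W_div, ← hdiff]
    field_simp
    ring
  rw [e]
  refine (norm_add_le _ _).trans ?_
  rw [norm_div, norm_mul, norm_div, norm_mul, norm_real, Real.norm_eq_abs, abs_of_nonneg hu.1]
  have h1 : ‖W D 1 u - W D 1 0‖ / ‖cutPt 1 u - s‖ ≤ 4 * (M * u) := by
    rw [div_le_iff₀ (by linarith)]
    nlinarith
  have h2 : ‖W D 1 0‖ * (u / (‖cutPt 1 u - s‖ * ‖cutPt 1 0 - s‖)) ≤ Wm * (16 * u) := by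
    refine mul_le_mul hW0 ?_ (div_nonneg hu.1 (by positivity)) hWm0
    rw [div_le_iff₀ (by positivity)]
    have : 1 / 16 ≤ ‖cutPt 1 u - s‖ * ‖cutPt 1 0 - s‖ := by nlinarith
    nlinarith [hu.1]
  linarith

/-- The amplitudes are continuous, hence measurable, on the cut. [folklore] -/
theorem continuousOn_q {n : ℤ} (hn : n ∈ D.S) (hσ : 1 < s.re) :
    ContinuousOn (q D s n) (Icc 0 D.ℓ₀) := by
  have hW := continuousOn_W (D := D) hn
  have hden : ContinuousOn (fun u : ℝ ↦ cutPt n u - s) (Icc 0 D.ℓ₀) := by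
    unfold cutPt; fun_prop
  have hne : ∀ u ∈ Icc 0 D.ℓ₀, cutPt n u - s ≠ 0 := by
    intro u hu h
    have := congrArg Complex.re h
    simp [cutPt] at this
    linarith [hu.1]
  have := hW.div hden hne
  exact this.congr fun u _ ↦ (q_eq_W_div s n u)

/-- Auxiliary step `aestronglyMeasurable_q` (see the module docstring). [folklore] -/
theorem aestronglyMeasurable_q {n : ℤ} (hn : n ∈ D.S) (hσ : 1 < s.re) {ℓ' : ℝ} (hℓ' : ℓ' ≤ D.ℓ₀) :
    AEStronglyMeasurable (q D s n) (volume.restrict (Ioc 0 ℓ')) :=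
  ((continuousOn_q hn hσ).mono (fun _ hu ↦ ⟨hu.1.le, hu.2.trans hℓ'⟩)).aestronglyMeasurable
    measurableSet_Ioc

end QBounds

/-! ## The cuts -/

section Cuts

variable {s : ℂ}

/-- `‖x^{(1 + in) − s}‖ = x^{1 − σ}`. [folklore] -/
theorem norm_xN_cpow (N : ℕ) (n : ℤ) (s : ℂ) :
    ‖(xN N : ℂ) ^ ((1 + n * I) - s)‖ = xN N ^ (1 - s.re) := by
  rw [norm_cpow_eq_rpow_re_of_pos (xN_pos N)]
  congr 1; simp

/-- `‖2 i sin(πμ)‖ ≤ 2`. [folklore] -/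
theorem norm_two_I_sin_le (μ : ℝ) : ‖(2 * I * (Real.sin (Real.pi * μ) : ℂ))‖ ≤ 2 := by
  rw [norm_mul, norm_mul, norm_I, mul_one, norm_real, Real.norm_eq_abs]
  have := Real.abs_sin_le_one (Real.pi * μ)
  have h2 : ‖(2 : ℂ)‖ = 2 := by simp
  rw [h2]
  nlinarith

/-- **The cuts `n ≠ 0` are small**: `‖cut_n‖ ≤ 8 W_max Γ(1 − μ_n) x^{1−σ} L'^{μ_n − 1}`.
[cite: Montgomery1983, §4 (22)] -/
theorem norm_cut_le (hL : 1 ≤ L N) (hσR : σR N < s.re) (ht : -(1 / 4 : ℝ) ≤ s.im ∧ s.im ≤ 3 / 4)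
    (hT : (D.K : ℝ) + 2 ≤ T N) {Wm : ℝ} (hWm : ∀ n ∈ D.S, ∀ u ∈ Icc 0 D.ℓ₀, ‖W D n u‖ ≤ Wm)
    {n : ℤ} (hn : n ∈ D.S) (hn0 : n ≠ 0) :
    ‖cut D N s n‖ ≤ 8 * Wm * Real.Gamma (1 - D.μ n) * (xN N ^ (1 - s.re) * L N ^ (D.μ n - 1)) := by
  have ht₀ : |s.im| < 1 := by rw [abs_lt]; constructor <;> linarith [ht.1, ht.2]
  have hσ : 1 < s.re := lt_trans (one_lt_σR hL) hσR
  have hℓ := ℓ_pos (K := D.K) hL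
  have hℓ₀ := ℓ_le_ℓ₀ hT
  have hL0 : 0 < L N := by linarith
  rw [cut_eq hL hσR ht₀ hT hn, norm_mul, norm_mul, norm_xN_cpow]
  have hint := norm_setIntegral_rpowExpWeight_mul_le (q := q D s n) (D.μ_lt_one n) hL0 hℓ
    (B := 4 * Wm) (fun u hu ↦ norm_q_le hWm hn hn0 ht ⟨hu.1.le, hu.2.trans hℓ₀⟩)
  have h2 := norm_two_I_sin_le (D.μ n)
  have hx0 : 0 ≤ xN N ^ (1 - s.re) := Real.rpow_nonneg (xN_pos N).le _
  have hG0 : 0 ≤ Real.Gamma (1 - D.μ n) * L N ^ (D.μ n - 1) :=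
    mul_nonneg (Real.Gamma_pos_of_pos (by linarith [D.μ_lt_one n])).le (Real.rpow_nonneg hL0.le _)
  have hWm0 : 0 ≤ Wm := by
    have := hWm 1 D.one_mem 0 ⟨le_rfl, D.ℓ₀_pos.le⟩
    exact (norm_nonneg _).trans this
  calc ‖2 * I * (Real.sin (Real.pi * D.μ n) : ℂ)‖ * xN N ^ (1 - s.re) *
        ‖∫ u in Ioc 0 (ℓ D.K N), ((u ^ (-D.μ n) * Real.exp (-(L N * u)) : ℝ) : ℂ) * q D s n u‖
      ≤ 2 * xN N ^ (1 - s.re) * (4 * Wm * (Real.Gamma (1 - D.μ n) * L N ^ (D.μ n - 1))) := by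
        refine mul_le_mul (mul_le_mul_of_nonneg_right h2 hx0) hint (norm_nonneg _) (by positivity)
    _ = 8 * Wm * Real.Gamma (1 - D.μ n) * (xN N ^ (1 - s.re) * L N ^ (D.μ n - 1)) := by ring

/-- **The cut at height `0`**: `‖cut_0‖ ≤ 2 W_max Γ(1 − μ₀) x^{1−σ} L'^{μ₀−1}/(σ − 1)`.
[cite: Montgomery1983, §4 (23)] -/
theorem norm_cut_zero_le (hL : 1 ≤ L N) (hσR : σR N < s.re) (ht : -(1 / 4 : ℝ) ≤ s.im ∧ s.im ≤ 3 / 4)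
    (hT : (D.K : ℝ) + 2 ≤ T N) {Wm : ℝ} (hWm : ∀ n ∈ D.S, ∀ u ∈ Icc 0 D.ℓ₀, ‖W D n u‖ ≤ Wm)
    (h0 : (0 : ℤ) ∈ D.S) :
    ‖cut D N s 0‖ ≤ 2 * Wm * Real.Gamma (1 - D.μ 0) *
      (xN N ^ (1 - s.re) * L N ^ (D.μ 0 - 1) / (s.re - 1)) := by
  have ht₀ : |s.im| < 1 := by rw [abs_lt]; constructor <;> linarith [ht.1, ht.2]
  have hσ : 1 < s.re := lt_trans (one_lt_σR hL) hσR
  have hℓ := ℓ_pos (K := D.K) hL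
  have hℓ₀ := ℓ_le_ℓ₀ hT
  have hL0 : 0 < L N := by linarith
  have hpos : 0 < s.re - 1 := by linarith
  rw [cut_eq hL hσR ht₀ hT h0, norm_mul, norm_mul]
  have hx : ‖(xN N : ℂ) ^ ((1 + ((0 : ℤ) : ℂ) * I) - s)‖ = xN N ^ (1 - s.re) := norm_xN_cpow N 0 s
  rw [hx]
  have hint := norm_setIntegral_rpowExpWeight_mul_le (q := q D s 0) (D.μ_lt_one 0) hL0 hℓ
    (B := Wm / (s.re - 1)) (fun u hu ↦ norm_q_zero_le hWm h0 hσ ⟨hu.1.le, hu.2.trans hℓ₀⟩)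
  have h2 := norm_two_I_sin_le (D.μ 0)
  have hx0 : 0 ≤ xN N ^ (1 - s.re) := Real.rpow_nonneg (xN_pos N).le _
  have hWm0 : 0 ≤ Wm := by
    have := hWm 1 D.one_mem 0 ⟨le_rfl, D.ℓ₀_pos.le⟩
    exact (norm_nonneg _).trans this
  have hG0 : 0 ≤ Real.Gamma (1 - D.μ 0) * L N ^ (D.μ 0 - 1) :=
    mul_nonneg (Real.Gamma_pos_of_pos (by linarith [D.μ_lt_one 0])).le (Real.rpow_nonneg hL0.le _)
  calc ‖2 * I * (Real.sin (Real.pi * D.μ 0) : ℂ)‖ * xN N ^ (1 - s.re) *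
        ‖∫ u in Ioc 0 (ℓ D.K N), ((u ^ (-D.μ 0) * Real.exp (-(L N * u)) : ℝ) : ℂ) * q D s 0 u‖
      ≤ 2 * xN N ^ (1 - s.re) * (Wm / (s.re - 1) * (Real.Gamma (1 - D.μ 0) * L N ^ (D.μ 0 - 1))) := by
        refine mul_le_mul (mul_le_mul_of_nonneg_right h2 hx0) hint (norm_nonneg _) (by positivity)
    _ = 2 * Wm * Real.Gamma (1 - D.μ 0) * (xN N ^ (1 - s.re) * L N ^ (D.μ 0 - 1) / (s.re - 1)) := by
        field_simp

/-- The main term of the main cut: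
`mainCut = 2i sin(πμ₁) x^{1+i−s} (H₁(1+i)/(1+i−s)) Γ(1−μ₁) L'^{μ₁−1}`. [cite: Montgomery1983, §4 (24)] -/
def mainCut (D : EulerTwistData) (N : ℕ) (s : ℂ) : ℂ :=
  2 * I * (Real.sin (Real.pi * D.μ 1) : ℂ) * (xN N : ℂ) ^ ((1 + ((1 : ℤ) : ℂ) * I) - s) *
    (D.H 1 (1 + I) / ((1 + I) - s) * ((Real.Gamma (1 - D.μ 1) * L N ^ (D.μ 1 - 1) : ℝ) : ℂ))

/-- **The main cut**: `‖cut_1 − mainCut‖ ≤ 2 x^{1−σ} ((4M + 16W_max) Γ(2−μ₁) L'^{μ₁−2}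
  + 4 W_max e^{−ℓL'/2} Γ(1−μ₁) (L'/2)^{μ₁−1})`. [cite: Montgomery1983, §4 (24)] -/
theorem norm_cut_one_sub_le (hL : 1 ≤ L N) (hσR : σR N < s.re) (ht : -(1 / 4 : ℝ) ≤ s.im ∧ s.im ≤ 3 / 4)
    (hT : (D.K : ℝ) + 2 ≤ T N) {Wm M : ℝ} (hWm : ∀ n ∈ D.S, ∀ u ∈ Icc 0 D.ℓ₀, ‖W D n u‖ ≤ Wm)
    (hM0 : 0 ≤ M) (hM : ∀ u ∈ Icc 0 D.ℓ₀, ‖W D 1 u - W D 1 0‖ ≤ M * u) :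
    ‖cut D N s 1 - mainCut D N s‖ ≤ 2 * xN N ^ (1 - s.re) *
      ((4 * M + 16 * Wm) * (Real.Gamma (2 - D.μ 1) * L N ^ (D.μ 1 - 2)) +
        4 * Wm * (Real.exp (-(ℓ D.K N * L N / 2)) * (Real.Gamma (1 - D.μ 1) * (L N / 2) ^ (D.μ 1 - 1)))) := by
  have ht₀ : |s.im| < 1 := by rw [abs_lt]; constructor <;> linarith [ht.1, ht.2]
  have hσ : 1 < s.re := lt_trans (one_lt_σR hL) hσR
  have hℓ := ℓ_pos (K := D.K) hL
  have hℓ₀ := ℓ_le_ℓ₀ hT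
  have hL0 : 0 < L N := by linarith
  have hWm0 : 0 ≤ Wm := by
    have := hWm 1 D.one_mem 0 ⟨le_rfl, D.ℓ₀_pos.le⟩
    exact (norm_nonneg _).trans this
  -- the Laplace expansion of `∫ w q₁`
  have hexp := norm_setIntegral_rpowExpWeight_mul_sub_le (q := q D s 1) (D.μ_lt_one 1) hL0 hℓ
    (M := 4 * M + 16 * Wm) (by linarith) (aestronglyMeasurable_q D.one_mem hσ hℓ₀)
    (q₀ := q D s 1 0) (fun u hu ↦ norm_q_one_sub_le hWm hM ht ⟨hu.1.le, hu.2.trans hℓ₀⟩)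
  have hq0 : ‖q D s 1 0‖ ≤ 4 * Wm := norm_q_le hWm D.one_mem one_ne_zero ht ⟨le_rfl, D.ℓ₀_pos.le⟩
  -- `cut₁ − mainCut = (2i sin πμ₁) x^{…} (∫ w q₁ − q₁(0) Γ L^{μ₁−1})`
  set c : ℂ := 2 * I * (Real.sin (Real.pi * D.μ 1) : ℂ) * (xN N : ℂ) ^ ((1 + ((1 : ℤ) : ℂ) * I) - s)
    with hc
  have e : cut D N s 1 - mainCut D N s = c * ((∫ u in Ioc 0 (ℓ D.K N),
      ((u ^ (-D.μ 1) * Real.exp (-(L N * u)) : ℝ) : ℂ) * q D s 1 u) -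
        q D s 1 0 * ((Real.Gamma (1 - D.μ 1) * L N ^ (D.μ 1 - 1) : ℝ) : ℂ)) := by
    rw [cut_eq hL hσR ht₀ hT D.one_mem, mainCut, q_one_zero, hc, mul_sub]
  rw [e, norm_mul]
  have hcn : ‖c‖ ≤ 2 * xN N ^ (1 - s.re) := by
    rw [hc, norm_mul, norm_xN_cpow]
    exact mul_le_mul_of_nonneg_right (norm_two_I_sin_le _) (Real.rpow_nonneg (xN_pos N).le _)
  refine mul_le_mul hcn (hexp.trans ?_) (norm_nonneg _)
    (mul_nonneg zero_le_two (Real.rpow_nonneg (xN_pos N).le _))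
  have hG1 : 0 ≤ Real.exp (-(ℓ D.K N * L N / 2)) * (Real.Gamma (1 - D.μ 1) * (L N / 2) ^ (D.μ 1 - 1)) :=
    mul_nonneg (Real.exp_pos _).le (mul_nonneg (Real.Gamma_pos_of_pos (by linarith [D.μ_lt_one 1])).le
      (Real.rpow_nonneg (by positivity) _))
  have := mul_le_mul_of_nonneg_right hq0 hG1
  linarith

end Cuts

/-! ## The far edges -/

section Edges

variable {s : ℂ}

/-- Auxiliary step `one_le_xN` (see the module docstring). [folklore] -/
theorem one_le_xN (hL : 1 ≤ L N) : 1 ≤ xN N := by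
  have h : Real.exp 1 ≤ xN N := by
    rw [← Real.le_log_iff_exp_le (xN_pos N)]; exact hL
  have := Real.add_one_le_exp (1 : ℝ)
  linarith

/-- On a horizontal edge at height `t ± T`: `‖g‖ ≤ Gbound(1) x^{σ_R − σ}/T`. [folklore] -/
theorem norm_g_horizontal_le (hL : 1 ≤ L N) (ht₀ : |s.im| < 1)
    (hT : (D.K : ℝ) + 2 ≤ T N) {x' : ℝ} (hx' : x' ∈ Icc (σL D.K N) (σR N)) {ε : ℝ}
    (hε : ε = 1 ∨ ε = -1) :
    ‖D.g N s ((x' : ℂ) + ((s.im + ε * T N : ℝ) : ℂ) * I)‖ ≤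
      Gbound D 1 N * (xN N ^ (σR N - s.re) / T N) := by
  set z : ℂ := (x' : ℂ) + ((s.im + ε * T N : ℝ) : ℂ) * I with hz
  have hT0 := T_pos hL
  have hzre : z.re = x' := by simp [hz]
  have hzim : z.im = s.im + ε * T N := by simp [hz]
  have habsε : |ε| = 1 := by rcases hε with rfl | rfl <;> simp
  have him : |z.im - s.im| ≤ T N := by
    rw [hzim, show s.im + ε * T N - s.im = ε * T N by ring, abs_mul, habsε, one_mul, abs_of_pos hT0]
  have hfar : ∀ n ∈ D.S, T N - 1 - D.K ≤ |z.im - n| := by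
    intro n hn
    have h1 := D.abs_intCast_le_K hn
    have h2 : |ε * T N| = T N := by rw [abs_mul, habsε, one_mul, abs_of_pos hT0]
    have h3 : |ε * T N| ≤ |z.im - n| + |s.im - n| := by
      have := abs_add_le (z.im - n) (-(s.im - n))
      rw [show z.im - n + -(s.im - n) = ε * T N by rw [hzim]; ring, abs_neg] at this
      exact this
    have h4 : |s.im - n| ≤ |s.im| + |(n : ℝ)| := abs_sub _ _
    linarith [ht₀.le]
  have hz1 : ∀ n ∈ D.S, z - n * I ≠ 1 := by
    intro n hn h
    have := congrArg Complex.im h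
    simp only [sub_im, mul_im, intCast_re, I_im, mul_one, intCast_im, I_re, mul_zero, add_zero,
      one_im] at this
    have h' := hfar n hn
    rw [this, abs_zero] at h'
    linarith
  have hη : ∀ n ∈ D.S, (1 : ℝ) ≤ ‖z - n * I - 1‖ := by
    intro n hn
    have h1 : |(z - n * I - 1).im| ≤ ‖z - n * I - 1‖ := abs_im_le_norm _
    have h2 : (z - n * I - 1).im = z.im - n := by simp
    rw [h2] at h1
    linarith [hfar n hn]
  have hG := norm_G_le_contour hL ht₀ (by rw [hzre]; exact hx'.1)
    (by rw [hzre]; exact hx'.2.trans (σR_le_two hL)) him hz1 one_pos hη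
  -- the kernel
  have hk : ‖kernel N s z‖ ≤ xN N ^ (σR N - s.re) / T N := by
    rw [norm_kernel, hzre]
    have hnum : xN N ^ (x' - s.re) ≤ xN N ^ (σR N - s.re) :=
      Real.rpow_le_rpow_of_exponent_le (one_le_xN hL) (by linarith [hx'.2])
    have hden : T N ≤ ‖z - s‖ := by
      have h1 : |(z - s).im| ≤ ‖z - s‖ := abs_im_le_norm _
      have h2 : (z - s).im = ε * T N := by simp [hz]
      rw [h2, abs_mul, habsε, one_mul, abs_of_pos hT0] at h1
      exact h1
    have hzs : 0 < ‖z - s‖ := lt_of_lt_of_le hT0 hden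
    calc xN N ^ (x' - s.re) / ‖z - s‖ ≤ xN N ^ (σR N - s.re) / ‖z - s‖ :=
          div_le_div_of_nonneg_right hnum hzs.le
      _ ≤ xN N ^ (σR N - s.re) / T N :=
          div_le_div_of_nonneg_left (Real.rpow_nonneg (xN_pos N).le _) hT0 hden
  rw [g, norm_mul]
  exact mul_le_mul hG hk (norm_nonneg _) (Gbound_nonneg hL one_pos)

/-- **The top edge**: `‖top‖ ≤ 2 Gbound(1) x^{σ_R−σ}/T`. [cite: Montgomery1983, §4 (between (21) and (22))] -/
theorem norm_top_le (hL : 1 ≤ L N) (ht₀ : |s.im| < 1) (hT : (D.K : ℝ) + 2 ≤ T N) :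
    ‖top D N s‖ ≤ 2 * (Gbound D 1 N * (xN N ^ (σR N - s.re) / T N)) := by
  have hab : σL D.K N ≤ σR N := by linarith [σL_lt_one (K := D.K) hL, one_lt_σR hL]
  have h := intervalIntegral.norm_integral_le_of_norm_le_const (a := σL D.K N) (b := σR N)
    (f := fun x : ℝ ↦ D.g N s ((x : ℂ) + ((s.im + T N : ℝ) : ℂ) * I))
    (C := Gbound D 1 N * (xN N ^ (σR N - s.re) / T N)) (fun x hx ↦ by
      rw [uIoc_of_le hab] at hx
      have := norm_g_horizontal_le hL ht₀ hT (x' := x) ⟨hx.1.le, hx.2⟩ (ε := 1) (Or.inl rfl)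
      simpa using this)
  rw [top]
  refine h.trans ?_
  have hlen : |σR N - σL D.K N| ≤ 2 := by
    rw [abs_of_nonneg (by linarith)]
    have h1 := σR_le_two hL
    have h2 := σL_ge (K := D.K) hL
    linarith
  have h0 : 0 ≤ Gbound D 1 N * (xN N ^ (σR N - s.re) / T N) :=
    mul_nonneg (Gbound_nonneg hL one_pos) (div_nonneg (Real.rpow_nonneg (xN_pos N).le _) (T_pos hL).le)
  nlinarith

/-- **The bottom edge**: `‖bottom‖ ≤ 2 Gbound(1) x^{σ_R−σ}/T`. [cite: Montgomery1983, §4] -/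
theorem norm_bottom_le (hL : 1 ≤ L N) (ht₀ : |s.im| < 1)
    (hT : (D.K : ℝ) + 2 ≤ T N) :
    ‖bottom D N s‖ ≤ 2 * (Gbound D 1 N * (xN N ^ (σR N - s.re) / T N)) := by
  have hab : σL D.K N ≤ σR N := by linarith [σL_lt_one (K := D.K) hL, one_lt_σR hL]
  have h := intervalIntegral.norm_integral_le_of_norm_le_const (a := σL D.K N) (b := σR N)
    (f := fun x : ℝ ↦ D.g N s ((x : ℂ) + ((s.im - T N : ℝ) : ℂ) * I))
    (C := Gbound D 1 N * (xN N ^ (σR N - s.re) / T N)) (fun x hx ↦ by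
      rw [uIoc_of_le hab] at hx
      have := norm_g_horizontal_le hL ht₀ hT (x' := x) ⟨hx.1.le, hx.2⟩ (ε := -1) (Or.inr rfl)
      simpa [sub_eq_add_neg] using this)
  rw [bottom]
  refine h.trans ?_
  have hlen : |σR N - σL D.K N| ≤ 2 := by
    rw [abs_of_nonneg (by linarith)]
    have h1 := σR_le_two hL
    have h2 := σL_ge (K := D.K) hL
    linarith
  have h0 : 0 ≤ Gbound D 1 N * (xN N ^ (σR N - s.re) / T N) :=
    mul_nonneg (Gbound_nonneg hL one_pos) (div_nonneg (Real.rpow_nonneg (xN_pos N).le _) (T_pos hL).le)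
  nlinarith

/-- **The left edge**: `‖left‖ ≤ 2T · Gbound(ℓ) x^{σ_L−σ}/(σ − σ_L)`. [cite: Montgomery1983, §4 (the abscissa γ)] -/
theorem norm_left_le (hL : 1 ≤ L N) (hσR : σR N < s.re) (ht₀ : |s.im| < 1) :
    ‖left D N s‖ ≤ 2 * T N *
      (Gbound D (ℓ D.K N) N * (xN N ^ (σL D.K N - s.re) / (s.re - σL D.K N))) := by
  have hT0 := T_pos hL
  have hcd : s.im - T N ≤ s.im + T N := by linarith
  have h := intervalIntegral.norm_integral_le_of_norm_le_const (a := s.im - T N) (b := s.im + T N)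
    (f := fun y : ℝ ↦ D.g N s ((σL D.K N : ℂ) + (y : ℂ) * I))
    (C := Gbound D (ℓ D.K N) N * (xN N ^ (σL D.K N - s.re) / (s.re - σL D.K N))) (fun y hy ↦ by
      rw [uIoc_of_le hcd] at hy
      exact norm_g_left_le hL hσR ht₀ ⟨hy.1.le, hy.2⟩)
  rw [left]
  refine h.trans (le_of_eq ?_)
  rw [show s.im + T N - (s.im - T N) = 2 * T N by ring, abs_of_pos (by linarith)]
  ring

end Edges

/-! ## The pre-asymptotic estimate -/

section Assembly

variable {s : ℂ}

/-- The constant `𝔠 = (sin(πμ₁) Γ(1 − μ₁)/π) H₁(1 + i)` of the main term.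
[cite: Montgomery1983, §4 (24) (the constant D₂)] -/
def mainConst (D : EulerTwistData) : ℂ :=
  ((Real.sin (Real.pi * D.μ 1) * Real.Gamma (1 - D.μ 1) / Real.pi : ℝ) : ℂ) * D.H 1 (1 + I)

/-- The main term `Main(s) = 𝔠 x^{1+i−s} L'^{μ₁−1}/(1+i−s)` of `F_N(s) − F(s)`.
[cite: Montgomery1983, §4 (24)] -/
def mainTerm (D : EulerTwistData) (N : ℕ) (s : ℂ) : ℂ :=
  mainConst D * (xN N : ℂ) ^ ((1 + I) - s) * ((L N ^ (D.μ 1 - 1) : ℝ) : ℂ) / ((1 + I) - s)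

/-- `(1/2π)(−i)·mainCut = Main`. [folklore] -/
theorem mainCut_eq (N : ℕ) (s : ℂ) :
    (1 / (2 * Real.pi) : ℂ) * (-I * mainCut D N s) = mainTerm D N s := by
  have hπ : (Real.pi : ℂ) ≠ 0 := ofReal_ne_zero.2 Real.pi_ne_zero
  rw [mainCut, mainTerm, mainConst]
  push_cast
  field_simp
  ring_nf
  rw [I_sq]
  ring

/-- **The pre-asymptotic estimate of the twisted section.** For `L' ≥ 1`, `T ≥ K + 2`, `N ≥ 1`,
`σ_R < σ`, `−1/4 ≤ t ≤ 3/4`, with the uniform constants `W_max`, `M`: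
`‖F_N(s) − F(s) − Main(s)‖ ≤ (1/2π)·[Perron] + (1/2π)·[‖cut₁ − mainCut‖ + Σ_{n ≠ 1} ‖cut_n‖ + ‖bottom‖ + ‖top‖ + ‖left‖]`,
each bracket bounded as in this file. [cite: Montgomery1983, §4 (20)–(24)] -/
theorem norm_sub_mainTerm_le (hN : 1 ≤ N) (hL : 1 ≤ L N) (hσR : σR N < s.re)
    (ht : -(1 / 4 : ℝ) ≤ s.im ∧ s.im ≤ 3 / 4) (hT : (D.K : ℝ) + 2 ≤ T N)
    {Wm M : ℝ} (hWm : ∀ n ∈ D.S, ∀ u ∈ Icc 0 D.ℓ₀, ‖W D n u‖ ≤ Wm)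
    (hM0 : 0 ≤ M) (hM : ∀ u ∈ Icc 0 D.ℓ₀, ‖W D 1 u - W D 1 0‖ ≤ M * u) :
    ‖twistedPartialSum (D.f ·) N s - LSeries (D.f ·) s - mainTerm D N s‖ ≤
      1 / (2 * Real.pi) * (xN N ^ (σR N - s.re) * (2 / T N) *
          (6 * (1 + Real.log (N + 1)) + 2 * (L N + 1))) +
      1 / (2 * Real.pi) *
        (2 * xN N ^ (1 - s.re) *
            ((4 * M + 16 * Wm) * (Real.Gamma (2 - D.μ 1) * L N ^ (D.μ 1 - 2)) +
              4 * Wm * (Real.exp (-(ℓ D.K N * L N / 2)) *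
                (Real.Gamma (1 - D.μ 1) * (L N / 2) ^ (D.μ 1 - 1)))) +
          (∑ n ∈ (D.S.erase 1).erase 0,
              8 * Wm * Real.Gamma (1 - D.μ n) * (xN N ^ (1 - s.re) * L N ^ (D.μ n - 1))) +
          (if (0 : ℤ) ∈ D.S then 2 * Wm * Real.Gamma (1 - D.μ 0) *
              (xN N ^ (1 - s.re) * L N ^ (D.μ 0 - 1) / (s.re - 1)) else 0) +
          2 * (2 * (Gbound D 1 N * (xN N ^ (σR N - s.re) / T N))) +
          2 * T N * (Gbound D (ℓ D.K N) N * (xN N ^ (σL D.K N - s.re) / (s.re - σL D.K N)))) := by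
  have ht₀ : |s.im| < 1 := by rw [abs_lt]; constructor <;> linarith [ht.1, ht.2]
  have hdec := norm_sub_decomposition_le hN hL hσR ht₀ hT (D := D) (s₀ := s)
  -- split off the main cut
  have h1S : (1 : ℤ) ∈ D.S := D.one_mem
  have hsum : ∑ n ∈ D.S, cut D N s n = cut D N s 1 + ∑ n ∈ D.S.erase 1, cut D N s n :=
    (Finset.add_sum_erase _ _ h1S).symm
  set A : ℂ := twistedPartialSum (D.f ·) N s - LSeries (D.f ·) s with hA
  set rest : ℂ := -I * (cut D N s 1 - mainCut D N s) + -I * (∑ n ∈ D.S.erase 1, cut D N s n) +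
    I * bottom D N s - I * top D N s + left D N s with hrest
  have e : A - mainTerm D N s =
      (A - (1 / (2 * Real.pi) : ℂ) * (-I * (∑ n ∈ D.S, cut D N s n) + I * bottom D N s -
        I * top D N s + left D N s)) + (1 / (2 * Real.pi) : ℂ) * rest := by
    rw [← mainCut_eq, hsum, hrest]; ring
  rw [e]
  refine (norm_add_le _ _).trans (add_le_add hdec ?_)
  rw [norm_mul]
  have hn : ‖(1 / (2 * Real.pi) : ℂ)‖ = 1 / (2 * Real.pi) := by
    rw [show (1 / (2 * Real.pi) : ℂ) = ((1 / (2 * Real.pi) : ℝ) : ℂ) by push_cast; ring]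
    rw [norm_real, Real.norm_eq_abs, abs_of_pos (by positivity)]
  rw [hn]
  refine mul_le_mul_of_nonneg_left ?_ (by positivity)
  -- the five pieces of `rest`
  have hI : ∀ w : ℂ, ‖-I * w‖ = ‖w‖ := fun w ↦ by rw [norm_mul, norm_neg, norm_I, one_mul]
  have hI' : ∀ w : ℂ, ‖I * w‖ = ‖w‖ := fun w ↦ by rw [norm_mul, norm_I, one_mul]
  have p1 := norm_cut_one_sub_le hL hσR ht hT hWm hM0 hM (D := D) (N := N) (s := s)
  have p2 : ‖∑ n ∈ D.S.erase 1, cut D N s n‖ ≤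
      (∑ n ∈ (D.S.erase 1).erase 0,
          8 * Wm * Real.Gamma (1 - D.μ n) * (xN N ^ (1 - s.re) * L N ^ (D.μ n - 1))) +
        (if (0 : ℤ) ∈ D.S then 2 * Wm * Real.Gamma (1 - D.μ 0) *
          (xN N ^ (1 - s.re) * L N ^ (D.μ 0 - 1) / (s.re - 1)) else 0) := by
    by_cases h0 : (0 : ℤ) ∈ D.S
    · have h0' : (0 : ℤ) ∈ D.S.erase 1 := Finset.mem_erase.2 ⟨by norm_num, h0⟩
      rw [if_pos h0, ← Finset.add_sum_erase _ _ h0']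
      refine (norm_add_le _ _).trans ?_
      rw [add_comm]
      refine add_le_add (norm_sum_le _ _ |>.trans (Finset.sum_le_sum fun n hn ↦ ?_))
        (norm_cut_zero_le hL hσR ht hT hWm h0)
      have hn' := Finset.mem_erase.1 hn
      have hn'' := Finset.mem_erase.1 hn'.2
      exact norm_cut_le hL hσR ht hT hWm hn''.2 hn'.1
    · rw [if_neg h0, add_zero]
      have : (D.S.erase 1).erase 0 = D.S.erase 1 :=
        Finset.erase_eq_of_notMem (fun h ↦ h0 (Finset.mem_of_mem_erase h))
      rw [this]
      refine norm_sum_le _ _ |>.trans (Finset.sum_le_sum fun n hn ↦ ?_)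
      have hn' := Finset.mem_erase.1 hn
      exact norm_cut_le hL hσR ht hT hWm hn'.2 (fun h ↦ h0 (h ▸ hn'.2))
  have p3 := norm_bottom_le hL ht₀ hT (D := D) (N := N) (s := s)
  have p4 := norm_top_le hL ht₀ hT (D := D) (N := N) (s := s)
  have p5 := norm_left_le hL hσR ht₀ (D := D) (N := N) (s := s)
  rw [hrest]
  calc ‖-I * (cut D N s 1 - mainCut D N s) + -I * (∑ n ∈ D.S.erase 1, cut D N s n) +
          I * bottom D N s - I * top D N s + left D N s‖
      ≤ ‖-I * (cut D N s 1 - mainCut D N s)‖ + ‖-I * (∑ n ∈ D.S.erase 1, cut D N s n)‖ +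
          ‖I * bottom D N s‖ + ‖I * top D N s‖ + ‖left D N s‖ := by
        refine (norm_add_le _ _).trans (add_le_add ?_ le_rfl)
        refine (norm_sub_le _ _).trans (add_le_add ?_ le_rfl)
        refine (norm_add_le _ _).trans (add_le_add ?_ le_rfl)
        exact norm_add_le _ _
    _ ≤ _ := by
        rw [hI, hI, hI', hI']
        linarith [p1, p2, p3, p4, p5]

end Assembly

end EulerTwistData

end Literature.Barriers.RiemannHypothesis

end
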